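import Mathlib
import HarnessLib
import HarnessLib.Audit
import Summits.AnomalousDissipation.Statement
import Summits.AnomalousDissipation.AnomalousDissipation.Theses.EnsembleRigidity
import Literature.Analysis.FluidPDE.StatisticalSolutionEnergyEq
import Summits.AnomalousDissipation.AnomalousDissipation.Theorems.TaylorCertificatesSteadyStatesLoudBoundedStubGpAdmissible
import HarnessLib.Audit.Status.Attr

/-!
Route: TameRoughRigidity

DORMANT since 2026-08-26T12:41:15Z (reconciler: no traction for 7.7 d (last activity item-evidence-added at 2026-08-18T18:56:01Z); parked, not closed — `ledger route dormant route-AnomalousDissipation-TameRoughRigidity --off` to reactiv) — unstaffed, not closed; items shared with open routes are served there. `ledger route dormant <id> --off` reactivates.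

# Route TameRoughRigidity — split statistical Lamb rigidity of f_GP by enstrophy regime —
coercivity, tame closure, conditional Onsager calibration — with the vacuity patch proved

DECOMPOSITION-FIRST (lens 3.4) of the summit-strength leaf X =
EnsembleRigidity.GPStatisticalRigidity (stmt-15508, tier-B ceiling:
"may be as hard as the summit"), f_GP = sin(2πx₂)e₀ + sin(2πx₀)e₁ + sin(2πx₁)e₂ pinned
byte-identically. It suffices to show N ∧ K ∧ R
(and the parent's unchanged existence half B = GPMeanBoundedFamily, stmt-15509, shared): (N,
GPEulerCoercive) f_GP carries NO
stationary statistical solution of the forced EULER equations in the FMRT class (finite mean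
enstrophy, cylindrical Liouville identity,
shell energy inequality) — the qualitative R = 0 core of X; (K, TameClosure) TAME CLOSURE: at every
energy level E and mean-enstrophy
level G₁, if tame near-statistics with cylindrical forced-Euler defect ≤ r exist for every r > 0, an
exact Euler statistics with the
same bounds exists — a compactness lemma; (R, TameToRough) CONDITIONAL ONSAGER CALIBRATION: if every
tame class carries a defect gap,
then at every level E there is a roughness threshold G₁(E) above which admissible near-statistics
with defect ≤ R ≤ δ₀ pay c ≤ R·√G.
The implication N → K → R → X is PROVED (glue.lean / Sketch.lean, rc 0, 0 sorry, axioms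
propext·choice·Quot.sound; ≈ 30 tactic lines,
not a one-liner: contraposition N+K ⇒ gap; R(gap) ⇒ calibration with its own G₁(E); patching with
δ₀' = min δ₀ (r/2), the tame case
being VACUOUS because defect ≤ r/2 contradicts the gap r). Cards: euler-coercive-force (object of
N), virtual-dissipation-magic-cone
(the residual lever of X), forced-small-scales-h1-coercivity-wad-rung (FSS 1440 = N up to an axis
swap).
Lean: `GPEulerCoercive ∧ TameClosure ∧ TameToRough ∧ GPMeanBoundedFamily ∧ ResidualTransferSSS ∧
EnsembleFloorTransfer` (the last two are the parent's LANDED bridge items stmt-15510/15511, carried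
as shared support copies)

## Assembly
`closes : GPEulerCoercive → TameClosure → TameToRough → GPMeanBoundedFamily → ResidualTransferSSS →
EnsembleFloorTransfer → AnomalousDissipation`
is PROVED in glue.lean (rev 1): the `have hX : EnsembleRigidity.GPStatisticalRigidity` block is the
typed split N → K → R → X (above),
then the parent route's certified deciding theorem `EnsembleRigidity.closes hX h₄ h₅ h₆`. REV 1
(cone repair, 2026-08-17): the parent's
two bridge items ResidualTransferSSS (stmt-15510, proved by
Theorems.ResidualTransferSSS.ResidualTransferSSS_of @ 45f501a) and
EnsembleFloorTransfer (stmt-15511, proved by Theorems.EnsembleFloorTransfer_proof @ 9e2071c) are no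
longer discharged BY NAME inside
`closes` — that required importing the two Theorems files, whose transitive imports
(TimeAverageEnstrophy → … → Vorticity;
TaylorCertificatesEnsembleCeilingTransfer → TimeAverageMeasureExistence → StatisticalSolutions) put
111 extra Literature modules and
their unproved named facts (Vorticity.IsVorticitySolutionOn.exists_pressure,
deprecated/refuted-as-stated; StatisticalSolutions.EnsembleZerothLaw,
an open conjecture; neither used by any decl here) into the route's import cone and starved it of
provers. They are now byte-identical
route-local SUPPORT copies (stmt-18616/18617, definitionally the parent decls; one-line proofs by
the landed theorems attached as item
evidence for a prover to land) and hypotheses h₅ h₆ of `closes`; the route file imports only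
Theses.EnsembleRigidity and
Literature.Analysis.FluidPDE.StatisticalSolutionEnergyEq (Torus.frameField for GPOrientationBridge),
so its import cone is the parent's
plus three proof-only modules. The route-local copies of X (target) and B (crux) are byte-identical
to stmt-15508/15509 and
definitionally the parent decls. The support RigiditySplit (N → K → R → X) is proved in Sketch.lean
for a prover to land verbatim, and is
the glue the parent's tenure planner can use for `route edit … --split GPStatisticalRigidity`.
In one line: `closes h₁ h₂ h₃ h₄ h₅ h₆ := EnsembleRigidity.closes (split h₁ h₂ h₃) h₄ h₅ h₆`, PROVED
(glue.lean; Sketch.lean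
`closes`/`assembly_holds`, rc 0, 0 sorry, axioms propext/Classical.choice/Quot.sound).

Rationale: WHY THIS LINE. X fuses three different kinds of mathematics under one quantifier block: an EXISTENCE
question (does f_GP carry a tame = finite-enstrophy
stationary Euler statistics? — Friedlander–Glatt-Holtz–Vicol arXiv:1404.1098 §2.3 "outstanding open
problem"; all refutation traffic on X
so far, Disproof.lean §7 Parts A–D and census j020739, attacks exactly this), a COMPACTNESS question
(do tame near-statistics close up? —
the lead's σ-analysis: "NoExact ⇒ crux must first prove σ = 0"), and an ONSAGER question (do rough
near-statistics pay R√G ≥ c? —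
Constantin–E–Titi doi:10.1007/bf02099744, Fjordholm–Wiedemann arXiv:1706.04113 Thm 3.8,
Drivas–Eyink). Cutting X by ENSTROPHY
REGIME separates them: at bounded mean enstrophy the σ-escape is harmless (high-frequency escape
carries energy ≤ G₁/(4π²K²), low-frequency
escape is invisible to FMRT's compactly supported cylindrical profiles; cutoff tests χ(|P_K v|²/ρ)·Φ
with ρ ≫ K³ control the cubic flux
term), so K is provable in kind (Prokhorov + Rellich + Bernstein); N becomes FSS's coercivity object
pinned to f_GP (= ForcedSmallScales
stmt-1440 up to the isometry x₁ ↔ x₂, filed as the support GPOrientationBridge) and is attackable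
level-wise by finite-dimensional /
computer-assisted rigidity (Kishimoto–Yoneda arXiv:2110.08039, the hand proof "no two-shell Beltrami
dodger", census continuation); R is
stated CONDITIONALLY on the tame gap because the unconditional rough calibration morally re-contains
N (an exact tame core convolved with
isotropic homogeneous high-frequency noise fakes roughness in the cylindrical metric: odd moments
vanish, the isotropic stress pairs with
∇Φ' to c∫div Φ' = 0; noising a core with a positive gap only increases R√G). Imported: statistical
solutions (FMRT2001 Ch. IV; CTV2013
arXiv:1305.7089 §§4–7 is the 2-D engine that passes SSS to the inviscid limit with uniform bounds),
Onsager/Duchon–Robert defect calculus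
for statistical solutions (arXiv:1706.04113), the parent's residual×roughness lever
(VirtualDissipation). What no listed route does: no
route on the summit splits a statistics-rigidity crux by regime with a proved patching lemma; the
parent's own two-layer plan was
N → (OnsagerUpgrade : N → X) (modus ponens, all of X's quantitative content in the upgrade).

RANKED CRUXES. #0 GPStatisticalRigidity (target) — X = STATISTICAL LAMB RIGIDITY OF f_GP
(EnsembleRigidity stmt-15508, byte-identical, shared): for every E there are c, δ₀ > 0 such that
every Borel probability measure on H with integrable energy ≤ E, finite mean enstrophy, non-negative
shell work and cylindrical forced-Euler defect ≤ R ≤ δ₀ pays c ≤ R·√G. (why it might fail: one tame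
Euler statistics of f_GP (exact dodger, orbit measure) kills it at its level; or an
Onsager-supercritical roughening sequence with R√G → 0 (IDES2025-type vanishing anomaly).)
[arXiv:1404.1098, arXiv:1305.7089, FoiasManleyRosaTemam2001,
Summits/AnomalousDissipation/AnomalousDissipation/Theses/EnsembleRigidity.lean]
#2 GPEulerCoercive (crux) — N — f_GP IS EULER-COERCIVE IN THE FMRT CLASS: no Borel probability
measure on H is a stationary statistical solution of the Euler equations forced by f_GP
(IsStationaryStatisticalSolution 0 f_GP μ: finite mean enstrophy, ∫⟨f_GP − B(v,v), Φ'(v)⟩dμ = 0 for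
all cylindrical Φ, ∫_shell (v,f_GP)dμ ≥ 0). The R = 0 kill class of X negated (X → N is the landed
Negative/EulerSSS.not_gpStatisticalRigidity_of_eulerSSS); = ForcedSmallScales.CyclicForceCoercive
(stmt-1440) up to the axis swap x₁ ↔ x₂ (support GPOrientationBridge); by time reversal one may
assume μ even and, by the landed linear test, mean energy ≥ 3/(4π) (bc/GPEulerCoercive_birth.lean;
bc/Specials.lean N_special proves N below 3/(4π)). [difficulty: open-problem] (why it might fail:
ONE finite-enstrophy steady or recurrent forced-Euler flow balancing f_GP kills it: a convergent
continuation in K of the census' low-energy Galerkin dodger branch (E ≈ 1, G_min(K) saturating), a ≥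
3-shell Beltrami cancellation, or an ABC-class (F₀(x₁,x₂),F₁(x₂,x₀),F₂(x₀,x₁)) dodger.)
[arXiv:1404.1098, arXiv:2110.08039, arXiv:1305.7089, FoiasManleyRosaTemam2001,
Summits/AnomalousDissipation/AnomalousDissipation/Cruxes/GPStatisticalRigidity/Disproof.lean,
Summits/AnomalousDissipation/AnomalousDissipation/Theses/ForcedSmallScales.lean]
#3 TameToRough (crux) — R — CONDITIONAL ONSAGER CALIBRATION: IF every tame class (probability,
integrable energy ≤ E, mean enstrophy ≤ G₁) carries a cylindrical defect gap r(E,G₁) > 0 (no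
Φ-uniform bound |∫L₀Φ dμ| ≤ r‖∇Φ'‖_(L²(μ))), THEN for every E there are G₁, c, δ₀ > 0 such that
every admissible μ (probability, integrable energy ≤ E, finite mean enstrophy G ≥ G₁, shell work ≥
0) with defect ≤ R ≤ δ₀ pays c ≤ R·√G. The Onsager half of X, isolated ν-free and conditioned on the
gap (unconditionally it would re-contain N by noise-faking). Line: coarse-graining ⇒ small-defect
statistics are BROADBAND under the gap, then broadband + near-stationary ⇒ calibration
(bc/TameToRough_birth.lean; bc/Specials.lean R_special proves the conclusion at every E < 3/(4π)).
[deps: GPEulerCoercive, TameClosure] [difficulty: open-problem] (why it might fail: a genuinely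
rough violating sequence: mollifications of a B^(σ>1/3) stationary Euler statistics of f_GP with
zero Duchon–Robert defect (R√G ≍ ℓ^(3σ−1) → 0), or broadband bounds decaying like N⁻² so that only G
≳ log(1/R) is forced.) [arXiv:1706.04113, doi:10.1007/bf02099744, arXiv:1404.1098,
Literature.Barriers.AnomalousDissipation.DrivasEyink2019_lemma1_measurable,
Summits/AnomalousDissipation/AnomalousDissipation/Cruxes/GPStatisticalRigidity/Lines/Sketch.md]
#4 TameClosure (crux) — K — TAME CLOSURE: for all E, G₁: if for every r > 0 there is a probability
measure on H with integrable energy ≤ E, mean enstrophy ≤ G₁ and cylindrical forced-Euler defect ≤ r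
(Φ-uniformly, |∫L₀Φ dμ| ≤ r‖∇Φ'‖_(L²(μ))), then there is a stationary statistical solution of Euler
forced by f_GP (FMRT) with integrable energy ≤ E and mean enstrophy ≤ G₁. Proof plan: Chebyshev +
Rellich give tightness, Prokhorov a weak limit; lsc of energy/enstrophy; limit exactness through
cutoff cylindrical tests χ(|P_K v|²/ρ)·Φ (tail energy ≤ G₁/(4π²K²), band mass ≤ E/ρ, ρ ≫ K³ beats
the Bernstein constants of the flux term); symmetrise under v ↦ −v for the shell inequality
(bc/TameClosure_birth.lean, 3 stubs; bc/Specials.lean K_special proves K at every E < 3/(4π)).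
[difficulty: L] (why it might fail: the generator is unbounded (quadratic) and FMRT-stationarity in
d = 3 does not even give the energy EQUALITY (IV (1.31) is an axiom): a Reynolds stress at infinity
σ ≠ 0 (escaping energy the compactly supported profiles still see) would make the limit a
generalised, not a true, statistics.) [FoiasManleyRosaTemam2001, arXiv:1305.7089, arXiv:1411.3391,
doi:10.1016/0022-247x(91)90013-p,
Summits/AnomalousDissipation/AnomalousDissipation/Cruxes/GPStatisticalRigidity/Lines/Sketch.md]
#5 GPMeanBoundedFamily (crux) — B — TURBULENT SATURATION IN THE MEAN FOR f_GP (EnsembleRigidity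
stmt-15509, byte-identical, shared; unchanged): a level E, viscosities ν_j ∈ (0,1] → 0, global
Leray–Hopf solutions of NS_(ν_j)(f_GP) with H-valued lifts and limsup-mean energy ≤ E. [difficulty:
open-problem] (why it might fail: no ν-uniform mean-energy bound is known for any fixed 3-D force at
zero momentum (a priori ⟨|u|²⟩ ≲ ν⁻² only); GP families might laminarise onto runaway branches.)
[DoeringFoias2002, FoiasManleyRosaTemam2001, arXiv:2311.04182,
Summits/AnomalousDissipation/AnomalousDissipation/Theses/EnsembleRigidity.lean]
#9 RigiditySplit (support) — the typed split N → K → R → X, PROVED (Sketch.lean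
`rigiditySplit_holds`, rc 0, 0 sorry; ≈ 30 tactic lines: contraposition, R's threshold, vacuity
patch with δ₀' = min δ₀ (r/2)); the same proof is the `have hX` block of `closes`. A prover lands it
verbatim; it is the glue for the parent's `--split GPStatisticalRigidity --into GPEulerCoercive
TameClosure TameToRough`. [difficulty: provable-now] [FoiasManleyRosaTemam2001,
Summits/AnomalousDissipation/AnomalousDissipation/Theses/EnsembleRigidity.lean]
#9 GPOrientationBridge (support) — ORIENTATION BRIDGE: ForcedSmallScales.CyclicForceCoercive
(stmt-1440: no Euler SSS of f₁ = sin(2πx₁)e₀ + sin(2πx₂)e₁ + sin(2πx₀)e₂, stated verbatim) ↔ N. The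
swap σ : x₁ ↔ x₂ with components permuted accordingly is an isometry of T³ carrying f_GP to f₁;
Euler is covariant, so IsSSS 0 f_GP μ ↔ IsSSS 0 f₁ (σ_*μ) (push-forward on H: cylindrical tests,
shells, enstrophy are σ-invariant). Provable now (M); links the two routes' efforts on the same
object. [difficulty: provable-now]
[Summits/AnomalousDissipation/AnomalousDissipation/Theses/ForcedSmallScales.lean,
Summits/AnomalousDissipation/AnomalousDissipation/Theses/EnsembleRigidity.lean,
FoiasManleyRosaTemam2001]
#9 ResidualTransferSSS (support) — the parent's bridge item stmt-15510 (byte-identical shared copy,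
stmt-18616): for ν > 0 and every SSS of NS_ν(f) with integrable energy, shell work ≥ 0 and
cylindrical forced-Euler defect ≤ ν·√(ensembleEnstrophy)·‖∇Φ'‖; ALREADY PROVED
(Theorems.ResidualTransferSSS.ResidualTransferSSS_of @ 45f501a) — carried as a hypothesis of
`closes` since rev 1 so that the route file needs no Theorems import; one-line proof attached as
evidence. [difficulty: provable-now] [FoiasManleyRosaTemam2001,
Summits/AnomalousDissipation/AnomalousDissipation/Theorems/EnsembleRigidityResidualTransferSSS.lean]
#9 EnsembleFloorTransfer (support) — the parent's bridge item stmt-15511 (byte-identical shared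
copy, stmt-18617): for ν > 0, an ensemble dissipation floor on every SSS of NS_ν(f) with integrable
energy ≤ E transfers to the mean dissipation of every lifted global Leray–Hopf path with meanEnergy
≤ E; ALREADY PROVED (Theorems.EnsembleFloorTransfer_proof @ 9e2071c) — hypothesis of `closes` since
rev 1, one-line proof attached as evidence. [difficulty: provable-now] [FoiasManleyRosaTemam2001,
DoeringFoias2002,
Summits/AnomalousDissipation/AnomalousDissipation/Theorems/EnsembleRigidityEnsembleFloorTransfer.lean]

TWO-LAYER PLAN. Foreseen, NOT filed (the birth skeletons bc/*_birth.lean, all rc 0 with sorries =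
stubs, are the candidates): N ⇐ (EvenReduction: an Euler
SSS of f_GP may be taken even under v ↦ −v, provable now) → (EnergyFloor: every Euler SSS of f_GP
has mean energy ≥ 3/(4π), provable now
from the landed linear test) → (NoEvenHighSSS: the open content) → N, k = 3. K ⇐ (TightLimit:
Prokhorov + Rellich + lsc) → (LimitExact:
cutoff cylindrical tests) → (SymmetriseSSS) → K, k = 3. R ⇐ (Broadband: under the gap, small-defect
statistics at level E carry tail energy
≥ β(E,N) above every frequency N — coarse-graining commutator, provable in kind) →
(BroadbandCalibration: broadband + near-stationary ⇒
c ≤ R√G, the K41 content) → R, k = 2. Level-wise children of N (no Euler SSS with mean energy ≤ E₀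
for explicit E₀ ∈ [0.24, 0.37], via
the lead's linear-horizon numerics j020754 made rigorous by an SOS/interval certificate) once K
closes.

KILL CRITERIA. An Euler SSS of f_GP (exact finite-enstrophy dodger state, orbit measure of a
recurrent finite-enstrophy forced-Euler flow, converged
continuum limit of the census' bounded dodger ends) refutes N: close `refuted:GPEulerCoercive` — X,
the parent route and
VirtualDissipation.LambRigidGP die with it (shared enemy); CyclicForceCoercive (1440) refuted ⇒ same
via the bridge. An escaping
sequence inside Lean's CylindricalTest class with a non-stationary weak limit refutes K:
`refuted:TameClosure` is SUBSTANTIVE for this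
route (the split then needs generalised (μ,σ) statistics — a new route, not a repair). A rough
violating sequence under the gap refutes R
(and X): `refuted:TameToRough`. EnergyUnboundedNegZM (14642) at f_GP refutes B (shared with the
parent; no force pivot). Mooted by:
GPStatisticalRigidity proved directly (parent line C2), GPZerothLaw (FrustratedForces),
SteadyStatesLoudBounded, or the summit elsewhere.

NOT DECOMPOSED YET. The three birth lines above (layer 2, after a crux moves); the level-wise
versions of N and the E₀-thresholds; the quantitative gap
function r(E,G₁) (its decay rate in G₁ decides how much of R follows from N+K by coarse-graining: r
≳ G₁^(-1/4) would give R outright,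
the expected r ≍ G₁^(-1/2) leaves the Onsager content); the (μ,σ) generalised-statistics formulation
(only if K dies); symmetry-class
(Fix K, G-symmetric) restrictions of N; the GP ↔ cyclic orientation bridge's isometry lemma on H
(support, provable now).

CHEAPEST FALSIFIER. N: continue the hub's steady Galerkin dodger census of f_GP (j020739, K ≤ 14:
low branch E ≈ 0.9–1.4 with G_min growing 145 → 436) by
continuation IN K of the lowest-energy branch to K = 24–32: G_min(K) saturating with spill → 0 is an
exact finite-enstrophy dodger (N, X,
parent dead at once); G_min(K) → ∞ supports N. One refuter-day on kit; not runnable from this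
compute-free planner seat. In-Lean checks done
here: N, K and R's conclusion all PROVED below the linear horizon E < 3/(4π) (bc/Specials.lean, rc
0, 0 sorry) — the definitions compute.
K: a prover-week check whether Mathlib's Prokhorov/tightness API reaches Borel probability measures
on the Hilbert space H and whether an
escaping sequence can be written inside `CylindricalTest` (compact-support profiles) with a
non-stationary limit. R: mollify the census'
UV-heavy dodgers and tabulate R·√G along the mollification scale (kit, one day).

NUMBERS. ‖f_GP‖₂² = 3/2, ‖f_GP‖_(Ḣ⁻¹) = √1.5/(2π) ≈ 0.195 = defect of the state of rest; linear
horizon: X, N, K, R-conclusion proved for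
E < 3/(4π) ≈ 0.2387 (landed gpStatisticalRigidity_smallEnergy), numerically E₁ ≥ 0.366 (j020754),
absolute ceiling of linear
certificates √12·0.195 ≈ 0.675; census j020739: steady Galerkin dodgers at every K ≤ 14, lowest E ∈
[0.90, 1.97], min G among E ≤ 2 grows
82 → 436, min spill ∈ [0.15, 0.33] ≥ ‖f_GP‖_(Ḣ⁻¹), spill·√G ≥ 1.8; tail-energy bound at mean
enstrophy G₁: ∫|Q_K v|² dμ ≤ G₁/(4π²K²);
glue constants: δ₀' = min δ₀ (r/2), c unchanged; items at open: 8 (target, 4 cruxes incl. shared B,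
2 supports, assembly); rev 1: 10 (+ the 2 proved bridge supports); import cone 145 → 38 project
modules (parent EnsembleRigidity: 34).

DEFINITION REQUESTS. None load-bearing. Optional (would shorten N/K/R and the parent's items
15508/15510): `Literature.Analysis.FluidPDE.Torus.EulerDefectLE f μ R`
(the Φ-uniform cylindrical defect clause) and `Torus.tailEnergy N μ := ∫‖v − galerkinProj N v‖² dμ`;
an isometry-push-forward lemma for
IsStationaryStatisticalSolution under the hyperoctahedral group of T³ (for GPOrientationBridge).

Novelty: Searches (2026-08-17, this seat; local searchd reset ×1, OpenAlex daily budget exhausted, S2/arXiv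
429 after 3 queries — logged):
`lit search --source arxiv "statistical solutions Onsager conjecture energy conservation Euler"` (3:
arXiv:1706.04113 Fjordholm–Wiedemann,
2109.03572, 2404.10084); `… "Foias Rosa Temam convergence statistical solutions"` (1:
arXiv:1411.3391); `… "weak convergence stationary
statistical solutions Navier-Stokes inviscid limit"` (0); `lit search --source zbmath "stationary
statistical solutions Euler equations
inviscid limit"` (8: Constantin–Ramos arXiv:math/0611782, Robert 2003 "Statistical hydrodynamics
(Onsager revisited)", Ferrario 2023
doi:10.1016/j.jde.2022.09.034 …); `lit search --source crossref "weak limits of stationary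
statistical solutions Navier-Stokes vanishing
viscosity Euler"` (9: Chae 1991 doi:10.1016/0022-247x(91)90013-p — paywalled, acq-06659 filed; FMRT
Ch. IV doi:10.1017/cbo9780511546754.005;
Liao 1989); `… "Onsager conjecture statistical solutions energy conservation"` (8: CET94
doi:10.1007/bf02099744); `lit galaxy search
"stationary statistical solution Euler" | "vanishing viscosity limit of statistical solutions"
--star all` (0 / 2: Robinson–Rodrigo LMS
notes, SAM report); `lit read arXiv:1706.04113` (Thm 3.8 read, p.8); hub: ceiling_routes (2),
open_routes_cruxes (31 rows), both parent
route files, Cruxes/GPStatisticalRigidity/{Disproof.lean, PICKED.md, Lines/Sketch.md, Ideas ×5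
titles}, Negative/{LoadBearing, EulerSSS,
DiracS  [refs: 10.1016/j.jde.2022.09.034, 10.1016/0022-247x(91, 10.1017/cbo9780511546754.005, 10.1007/bf02099744, 1706.04113, 1411.3391, math/0611782, 1305.7089, 1404.1098, doi:10.1016/j.jde.2022.09.034, doi:10.1016/0022-247x, doi:10.1017/cbo9780511546754.005, doi:10.1007/bf02099744]

Barriers (technique_class: statistical-solutions, regime-split, compactness): - technique_class: statistical-solutions, regime-split, compactness
- Literature.Barriers.AnomalousDissipation.DrivasEyink2019_lemma1_measurable: bites R squarely and
is recorded as R's why-might-fail (a B^(σ>1/3) stationary Euler statistics of f_GP with vanishing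
Duchon–Robert defect refutes R and X); consistent in direction — under the tame gap loud families
have G = ε/ν → ∞ exactly as the lemma requires; N and K live entirely in the finite-enstrophy
(Onsager-subcritical-in-mean) class where it is silent.
- Literature.Barriers.AnomalousDissipation.BuckmasterVicol2019_thm13: evaded by the
finite-mean-enstrophy clause of the FMRT class — wild non-Leray steady/stationary solutions have
infinite enstrophy and are not admissible in N; K's limits stay in the class by lower semicontinuity
of the mean enstrophy.
- Literature.Barriers.AnomalousDissipation.Cheskidov2023_thm13_not_forceRobustNoAnomaly: n/a in
direction (positive route) and in kind: N is maximally NON-robust in f (pinned f_GP; the Kolmogorov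
force is not coercive, FSS stmt-1439), no estimate stable under C⁰-perturbation of the force is
used.
- Literature.Barriers.AnomalousDissipation.BrenierDeLellisSzekelyhidi2011_cor1: n/a — no
measure-valued weak-strong argument; K's limit objects are Borel measures on H tested cylindrically,
not Young measures, and no uniqueness is invoked.
- Literature.Barriers.AnomalousDissipation.BrueDeLellis2023_noAnomaly_beforeEulerSingularity: n/a —
no finite time window; time averages are tak

History (route lifecycle, newest last):
- 2026-08-17T02:51:50Z · rev 2: restated Assembly (stmt-AnomalousDissipation-18405) — rev 2: Assembly restated to the 6-ary type of the rev-1 deciding theorem (adds the two proved bridge supports ResidualTransferSSS, EnsembleFloorTransfer as hypo (planner-rrepair-AnomalousDissipation-TameRough-1126c1a3-0)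
- 2026-08-26T12:41:15Z · DORMANT — reconciler: no traction for 7.7 d (last activity item-evidence-added at 2026-08-18T18:56:01Z); parked, not closed — `ledger route dormant route-AnomalousDissipa (operator:999:2606221)

sub-problem: AnomalousDissipation · status: dormant · opened planner-plan-lens3-AnomalousDissipation-decomp-0 2026-08-17T02:31:29Z · rev 3 · ledger route-AnomalousDissipation-TameRoughRigidity
GENERATED by the gate from the ledger (D-0016/17). Provers cite these decls: `theorem foo : Summit.AnomalousDissipation.AnomalousDissipation.Theses.TameRoughRigidity.<Decl> := …` in Summits/AnomalousDissipation/AnomalousDissipation/Theorems/<Name>.lean.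
-/

namespace Summit.AnomalousDissipation.AnomalousDissipation.Theses.TameRoughRigidity

open scoped BigOperators Topology Manifold Classical MeasureTheory ProbabilityTheory Matrix InnerProductSpace ComplexConjugate ContinuousMap
open Filter Set Function TopologicalSpace MeasureTheory

attribute [summit_statement] _root_.AnomalousDissipation

open Literature.Turb

/-- item stmt-AnomalousDissipation-15508 · target · rank 0 · open · by planner
why it might fail: one tame Euler statistics of f_GP (exact dodger, orbit measure) kills it at its level; or an Onsager-supercritical roughening sequence with R√G → 0 (IDES2025-type vanishing anomaly).
sources: arXiv:1404.1098, arXiv:1305.7089, FoiasManleyRosaTemam2001, Summits/AnomalousDissipation/AnomalousDissipation/Theses/EnsembleRigidity.lean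
[crux] STATISTICAL LAMB RIGIDITY OF f_GP (new; from VirtualDissipation: the residual lever, now on
measures; from ForcedSmallScales 1434/1440 and card euler-coercive-force: the object, now
quantitative and level-wise). For every E there are c, δ₀ > 0 such that every Borel probability
measure μ on Torus.energySpace (Fin 3) with Integrable |v|², ensembleEnergy μ ≤ E, ensembleEnstrophy
μ < ⊤, non-negative work ∫_{e₁≤|v|²<e₂}(v,f_GP)dμ ≥ 0 on every energy shell, and cylindrical
forced-Euler defect |∫ nsGeneratorPairing 0 f_GP v (Φ.grad v) dμ| ≤ R·(∫ gradNormSq (Φ.grad v)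
dμ)^{1/2} for all Φ (integrand integrable), 0 ≤ R ≤ δ₀, satisfies c ≤ R·((ensembleEnstrophy
μ).toReal)^{1/2}. At a Dirac mass this is VirtualDissipation's single-field rigidity at level E
(plus (f,v) ≥ 0); at R = 0 it says f_GP carries no finite-enstrophy stationary Euler statistics of
mean energy ≤ E (the FMRT class of FSS's CyclicForceCoercive, GP orientation). [difficulty:
open-problem] -/
@[route_item "route-AnomalousDissipation-TameRoughRigidity", crux]
def GPStatisticalRigidity : Prop :=
  ∀ f : UnitAddTorus (Fin 3) → EuclideanSpace ℝ (Fin 3), f = (fun x : UnitAddTorus (Fin 3) => (Literature.Analysis.FluidPDE.Torus.stokesMode (Pi.single (2 : Fin 3) (1 : ℤ)) (EuclideanSpace.single (0 : Fin 3) (1 : ℝ)) false x + Literature.Analysis.FluidPDE.Torus.stokesMode (Pi.single (0 : Fin 3) (1 : ℤ)) (EuclideanSpace.single (1 : Fin 3) (1 : ℝ)) false x + Literature.Analysis.FluidPDE.Torus.stokesMode (Pi.single (1 : Fin 3) (1 : ℤ)) (EuclideanSpace.single (2 : Fin 3) (1 : ℝ)) false x : EuclideanSpace ℝ (Fin 3)))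 → ∀ E : ℝ, ∃ c δ₀ : ℝ, 0 < c ∧ 0 < δ₀ ∧ ∀ μ : MeasureTheory.Measure (Literature.Analysis.FunctionSpaces.Torus.energySpace (Fin 3)), MeasureTheory.IsProbabilityMeasure μ → MeasureTheory.Integrable (fun v : Literature.Analysis.FunctionSpaces.Torus.energySpace (Fin 3) => ‖v‖ ^ 2) μ → Literature.Analysis.FluidPDE.Torus.ensembleEnergy μ ≤ E → Literature.Analysis.FluidPDE.Torus.ensembleEnstrophy μ < ⊤ → (∀ e₁ e₂ : ENNReal, e₁ < e₂ → 0 ≤ ∫ v in {v : Literature.Analysis.FunctionSpaces.Torus.energySpace (Fin 3) | e₁ ≤ ‖v‖ₑ ^ 2 ∧ ‖v‖ₑ ^ 2 < e₂}, Literature.Analysis.FluidPDE.Torus.pairing (v : MeasureTheory.Lp (EuclideanSpace ℝ (Fin 3)) 2 (MeasureTheory.volume : MeasureTheory.Measure (UnitAddTorus (Fin 3)))) f ∂μ) → ∀ R : ℝ, 0 ≤ R → R ≤ δ₀ → (∀ Φ : Literature.Analysis.FluidPDE.Torus.CylindricalTest (Fin 3), MeasureTheory.Integrable (fun v : Literature.Analysis.FunctionSpaces.Torus.energySpace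 (Fin 3) => Literature.Analysis.FluidPDE.Torus.nsGeneratorPairing 0 f v (Φ.grad v)) μ ∧ |∫ v, Literature.Analysis.FluidPDE.Torus.nsGeneratorPairing 0 f v (Φ.grad v) ∂μ| ≤ R * Real.sqrt (∫ v, Literature.Analysis.FunctionSpaces.Torus.gradNormSq (Φ.grad v) ∂μ)) → c ≤ R * Real.sqrt (Literature.Analysis.FluidPDE.Torus.ensembleEnstrophy μ).toReal

/-- item stmt-AnomalousDissipation-18400 · crux · rank 2 · open · by planner
why it might fail: ONE finite-enstrophy steady or recurrent forced-Euler flow balancing f_GP kills it: a convergent continuation in K of the census' low-energy Galerkin dodger branch (E ≈ 1, G_min(K) saturating), a ≥ 3-shell Beltrami cancellation, or an ABC-class (F₀(x₁,x₂),F₁(x₂,x₀),F₂(x₀,x₁)) dodger.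
sources: arXiv:1404.1098, arXiv:2110.08039, arXiv:1305.7089, FoiasManleyRosaTemam2001, Summits/AnomalousDissipation/AnomalousDissipation/Cruxes/GPStatisticalRigidity/Disproof.lean, Summits/AnomalousDissipation/AnomalousDissipation/Theses/ForcedSmallScales.lean
[crux] N — f_GP IS EULER-COERCIVE IN THE FMRT CLASS: no Borel probability measure on H is a
stationary statistical solution of the Euler equations forced by f_GP
(IsStationaryStatisticalSolution 0 f_GP μ: finite mean enstrophy, ∫⟨f_GP − B(v,v), Φ'(v)⟩dμ = 0 for
all cylindrical Φ, ∫_shell (v,f_GP)dμ ≥ 0). The R = 0 kill class of X negated (X → N is the landed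
Negative/EulerSSS.not_gpStatisticalRigidity_of_eulerSSS); = ForcedSmallScales.CyclicForceCoercive
(stmt-1440) up to the axis swap x₁ ↔ x₂ (support GPOrientationBridge); by time reversal one may
assume μ even and, by the landed linear test, mean energy ≥ 3/(4π) (bc/GPEulerCoercive_birth.lean;
bc/Specials.lean N_special proves N below 3/(4π)). [difficulty: open-problem] -/
@[route_item "route-AnomalousDissipation-TameRoughRigidity", crux]
def GPEulerCoercive : Prop :=
  ∀ f : UnitAddTorus (Fin 3) → EuclideanSpace ℝ (Fin 3), f = (fun x : UnitAddTorus (Fin 3) => (Literature.Analysis.FluidPDE.Torus.stokesMode (Pi.single (2 : Fin 3) (1 : ℤ)) (EuclideanSpace.single (0 : Fin 3) (1 : ℝ)) false x + Literature.Analysis.FluidPDE.Torus.stokesMode (Pi.single (0 : Fin 3) (1 : ℤ)) (EuclideanSpace.single (1 : Fin 3) (1 : ℝ)) false x + Literature.Analysis.FluidPDE.Torus.stokesMode (Pi.single (1 : Fin 3) (1 : ℤ)) (EuclideanSpace.single (2 : Fin 3) (1 : ℝ)) false x : EuclideanSpace ℝ (Fin 3))) → ∀ μ : MeasureTheory.Measure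 (Literature.Analysis.FunctionSpaces.Torus.energySpace (Fin 3)), ¬ Literature.Analysis.FluidPDE.Torus.IsStationaryStatisticalSolution 0 f μ

/-- item stmt-AnomalousDissipation-18401 · crux · rank 3 · open · by planner
why it might fail: a genuinely rough violating sequence: mollifications of a B^(σ>1/3) stationary Euler statistics of f_GP with zero Duchon–Robert defect (R√G ≍ ℓ^(3σ−1) → 0), or broadband bounds decaying like N⁻² so that only G ≳ log(1/R) is forced.
sources: arXiv:1706.04113, doi:10.1007/bf02099744, arXiv:1404.1098, Literature.Barriers.AnomalousDissipation.DrivasEyink2019_lemma1_measurable, Summits/AnomalousDissipation/AnomalousDissipation/Cruxes/GPStatisticalRigidity/Lines/Sketch.md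
[crux] R — CONDITIONAL ONSAGER CALIBRATION: IF every tame class (probability, integrable energy ≤ E,
mean enstrophy ≤ G₁) carries a cylindrical defect gap r(E,G₁) > 0 (no Φ-uniform bound |∫L₀Φ dμ| ≤
r‖∇Φ'‖_(L²(μ))), THEN for every E there are G₁, c, δ₀ > 0 such that every admissible μ (probability,
integrable energy ≤ E, finite mean enstrophy G ≥ G₁, shell work ≥ 0) with defect ≤ R ≤ δ₀ pays c ≤
R·√G. The Onsager half of X, isolated ν-free and conditioned on the gap (unconditionally it would
re-contain N by noise-faking). Line: coarse-graining ⇒ small-defect statistics are BROADBAND under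
the gap, then broadband + near-stationary ⇒ calibration (bc/TameToRough_birth.lean; bc/Specials.lean
R_special proves the conclusion at every E < 3/(4π)). [deps: GPEulerCoercive, TameClosure]
[difficulty: open-problem] -/
@[route_item "route-AnomalousDissipation-TameRoughRigidity", crux]
def TameToRough : Prop :=
  ∀ f : UnitAddTorus (Fin 3) → EuclideanSpace ℝ (Fin 3), f = (fun x : UnitAddTorus (Fin 3) => (Literature.Analysis.FluidPDE.Torus.stokesMode (Pi.single (2 : Fin 3) (1 : ℤ)) (EuclideanSpace.single (0 : Fin 3) (1 : ℝ)) false x + Literature.Analysis.FluidPDE.Torus.stokesMode (Pi.single (0 : Fin 3) (1 : ℤ)) (EuclideanSpace.single (1 : Fin 3) (1 : ℝ)) false x + Literature.Analysis.FluidPDE.Torus.stokesMode (Pi.single (1 : Fin 3) (1 : ℤ)) (EuclideanSpace.single (2 : Fin 3) (1 : ℝ)) false x : EuclideanSpace ℝ (Fin 3))) → (∀ E G₁ : ℝ, ∃ r : ℝ, 0 < r ∧ ∀ μ : MeasureTheory.Measure (Literature.Analysis.FunctionSpaces.Torus.energySpace (Fin 3)), MeasureTheory.IsProbabilityMeasure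 μ → MeasureTheory.Integrable (fun v : Literature.Analysis.FunctionSpaces.Torus.energySpace (Fin 3) => ‖v‖ ^ 2) μ → Literature.Analysis.FluidPDE.Torus.ensembleEnergy μ ≤ E → Literature.Analysis.FluidPDE.Torus.ensembleEnstrophy μ ≤ ENNReal.ofReal G₁ → ¬ (∀ Φ : Literature.Analysis.FluidPDE.Torus.CylindricalTest (Fin 3), MeasureTheory.Integrable (fun v : Literature.Analysis.FunctionSpaces.Torus.energySpace (Fin 3) => Literature.Analysis.FluidPDE.Torus.nsGeneratorPairing 0 f v (Φ.grad v)) μ ∧ |∫ v, Literature.Analysis.FluidPDE.Torus.nsGeneratorPairing 0 f v (Φ.grad v) ∂μ| ≤ r * Real.sqrt (∫ v, Literature.Analysis.FunctionSpaces.Torus.gradNormSq (Φ.grad v) ∂μ))) → ∀ E : ℝ, ∃ G₁ c δ₀ : ℝ, 0 < c ∧ 0 < δ₀ ∧ ∀ μ : MeasureTheory.Measure (Literature.Analysis.FunctionSpaces.Torus.energySpace (Fin 3)), MeasureTheory.IsProbabilityMeasure μ → MeasureTheory.Integrable (fun v : Literature.Analysis.FunctionSpaces.Torus.energySpace (Fin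 3) => ‖v‖ ^ 2) μ → Literature.Analysis.FluidPDE.Torus.ensembleEnergy μ ≤ E → Literature.Analysis.FluidPDE.Torus.ensembleEnstrophy μ < ⊤ → ENNReal.ofReal G₁ ≤ Literature.Analysis.FluidPDE.Torus.ensembleEnstrophy μ → (∀ e₁ e₂ : ENNReal, e₁ < e₂ → 0 ≤ ∫ v in {v : Literature.Analysis.FunctionSpaces.Torus.energySpace (Fin 3) | e₁ ≤ ‖v‖ₑ ^ 2 ∧ ‖v‖ₑ ^ 2 < e₂}, Literature.Analysis.FluidPDE.Torus.pairing (v : MeasureTheory.Lp (EuclideanSpace ℝ (Fin 3)) 2 (MeasureTheory.volume : MeasureTheory.Measure (UnitAddTorus (Fin 3)))) f ∂μ) → ∀ R : ℝ, 0 ≤ R → R ≤ δ₀ → (∀ Φ : Literature.Analysis.FluidPDE.Torus.CylindricalTest (Fin 3), MeasureTheory.Integrable (fun v : Literature.Analysis.FunctionSpaces.Torus.energySpace (Fin 3) => Literature.Analysis.FluidPDE.Torus.nsGeneratorPairing 0 f v (Φ.grad v)) μ ∧ |∫ v, Literature.Analysis.FluidPDE.Torus.nsGeneratorPairing 0 f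 v (Φ.grad v) ∂μ| ≤ R * Real.sqrt (∫ v, Literature.Analysis.FunctionSpaces.Torus.gradNormSq (Φ.grad v) ∂μ)) → c ≤ R * Real.sqrt (Literature.Analysis.FluidPDE.Torus.ensembleEnstrophy μ).toReal

/-- item stmt-AnomalousDissipation-18402 · crux · rank 4 · closed · proved by Summit.AnomalousDissipation.AnomalousDissipation.Theorems.TameRoughRigidity.TameClosure.TameClosure_of @ b5325d8714b8 (prover) · by planner
why it might fail: the generator is unbounded (quadratic) and FMRT-stationarity in d = 3 does not even give the energy EQUALITY (IV (1.31) is an axiom): a Reynolds stress at infinity σ ≠ 0 (escaping energy the compactly supported profiles still see) would make the limit a generalised, not a true, statistics.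
sources: FoiasManleyRosaTemam2001, arXiv:1305.7089, arXiv:1411.3391, doi:10.1016/0022-247x(91)90013-p, Summits/AnomalousDissipation/AnomalousDissipation/Cruxes/GPStatisticalRigidity/Lines/Sketch.md
[crux] K — TAME CLOSURE: for all E, G₁: if for every r > 0 there is a probability measure on H with
integrable energy ≤ E, mean enstrophy ≤ G₁ and cylindrical forced-Euler defect ≤ r (Φ-uniformly,
|∫L₀Φ dμ| ≤ r‖∇Φ'‖_(L²(μ))), then there is a stationary statistical solution of Euler forced by f_GP
(FMRT) with integrable energy ≤ E and mean enstrophy ≤ G₁. Proof plan: Chebyshev + Rellich give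
tightness, Prokhorov a weak limit; lsc of energy/enstrophy; limit exactness through cutoff
cylindrical tests χ(|P_K v|²/ρ)·Φ (tail energy ≤ G₁/(4π²K²), band mass ≤ E/ρ, ρ ≫ K³ beats the
Bernstein constants of the flux term); symmetrise under v ↦ −v for the shell inequality
(bc/TameClosure_birth.lean, 3 stubs; bc/Specials.lean K_special proves K at every E < 3/(4π)).
[difficulty: L] -/
@[route_item "route-AnomalousDissipation-TameRoughRigidity", crux]
def TameClosure : Prop :=
  ∀ f : UnitAddTorus (Fin 3) → EuclideanSpace ℝ (Fin 3), f = (fun x : UnitAddTorus (Fin 3) => (Literature.Analysis.FluidPDE.Torus.stokesMode (Pi.single (2 : Fin 3) (1 : ℤ)) (EuclideanSpace.single (0 : Fin 3) (1 : ℝ)) false x + Literature.Analysis.FluidPDE.Torus.stokesMode (Pi.single (0 : Fin 3) (1 : ℤ)) (EuclideanSpace.single (1 : Fin 3) (1 : ℝ)) false x + Literature.Analysis.FluidPDE.Torus.stokesMode (Pi.single (1 : Fin 3) (1 : ℤ)) (EuclideanSpace.single (2 : Fin 3) (1 : ℝ)) false x : EuclideanSpace ℝ (Fin 3))) → ∀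 E G₁ : ℝ, (∀ r : ℝ, 0 < r → ∃ μ : MeasureTheory.Measure (Literature.Analysis.FunctionSpaces.Torus.energySpace (Fin 3)), MeasureTheory.IsProbabilityMeasure μ ∧ MeasureTheory.Integrable (fun v : Literature.Analysis.FunctionSpaces.Torus.energySpace (Fin 3) => ‖v‖ ^ 2) μ ∧ Literature.Analysis.FluidPDE.Torus.ensembleEnergy μ ≤ E ∧ Literature.Analysis.FluidPDE.Torus.ensembleEnstrophy μ ≤ ENNReal.ofReal G₁ ∧ (∀ Φ : Literature.Analysis.FluidPDE.Torus.CylindricalTest (Fin 3), MeasureTheory.Integrable (fun v : Literature.Analysis.FunctionSpaces.Torus.energySpace (Fin 3) => Literature.Analysis.FluidPDE.Torus.nsGeneratorPairing 0 f v (Φ.grad v)) μ ∧ |∫ v, Literature.Analysis.FluidPDE.Torus.nsGeneratorPairing 0 f v (Φ.grad v) ∂μ| ≤ r * Real.sqrt (∫ v, Literature.Analysis.FunctionSpaces.Torus.gradNormSq (Φ.grad v) ∂μ))) → ∃ μ : MeasureTheory.Measure (Literature.Analysis.FunctionSpaces.Torus.energySpace (Fin 3)), Literature.Analysis.FluidPDE.Torus.IsStationaryStatisticalSolution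 0 f μ ∧ MeasureTheory.Integrable (fun v : Literature.Analysis.FunctionSpaces.Torus.energySpace (Fin 3) => ‖v‖ ^ 2) μ ∧ Literature.Analysis.FluidPDE.Torus.ensembleEnergy μ ≤ E ∧ Literature.Analysis.FluidPDE.Torus.ensembleEnstrophy μ ≤ ENNReal.ofReal G₁

-- `TameClosure` holds: proved by `Summit.AnomalousDissipation.AnomalousDissipation.Theorems.TameRoughRigidity.TameClosure.TameClosure_of` @ b5325d8714b8 (its module imports this route file, so no `_holds` link can be stated here).

/-- item stmt-AnomalousDissipation-15509 · crux · rank 5 · open · by planner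
why it might fail: no ν-uniform mean-energy bound is known for any fixed 3-D force at zero momentum (a priori ⟨|u|²⟩ ≲ ν⁻² only); GP families might laminarise onto runaway branches.
sources: DoeringFoias2002, FoiasManleyRosaTemam2001, arXiv:2311.04182, Summits/AnomalousDissipation/AnomalousDissipation/Theses/EnsembleRigidity.lean
[crux] TURBULENT SATURATION IN THE MEAN FOR f_GP (from Correlation 14641 / ForcedSmallScales 1435:
the saturation half, pinned to f_GP, weakened from pathwise to limsup-mean, momentum killed by the
H-lift as the drift refutations 2979/2984/0204 demand). There are a level E, viscosities ν_j ∈ (0,1]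
with ν_j → 0, data u₀ⱼ, global Leray–Hopf solutions u_j of NS_{ν_j}(f_GP) and H-valued lifts U_j
(U_j t = u_j t a.e. for every t ≥ 0: zero momentum, weakly solenoidal slices) with meanEnergy (u_j)
≤ E for all j. Any zero-momentum bounded family — turbulent paths from rest, a bounded steady or
periodic GP branch realised as Leray–Hopf — fires it. [difficulty: open-problem] -/
@[route_item "route-AnomalousDissipation-TameRoughRigidity", crux]
def GPMeanBoundedFamily : Prop :=
  ∀ f : UnitAddTorus (Fin 3) → EuclideanSpace ℝ (Fin 3), f = (fun x : UnitAddTorus (Fin 3) => (Literature.Analysis.FluidPDE.Torus.stokesMode (Pi.single (2 : Fin 3) (1 : ℤ)) (EuclideanSpace.single (0 : Fin 3) (1 : ℝ)) false x + Literature.Analysis.FluidPDE.Torus.stokesMode (Pi.single (0 : Fin 3) (1 : ℤ)) (EuclideanSpace.single (1 : Fin 3) (1 : ℝ)) false x + Literature.Analysis.FluidPDE.Torus.stokesMode (Pi.single (1 : Fin 3) (1 : ℤ)) (EuclideanSpace.single (2 : Fin 3) (1 : ℝ)) false x : EuclideanSpace ℝ (Fin 3))) → ∃ (E : ℝ) (ν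 : ℕ → ℝ) (u₀ : ℕ → UnitAddTorus (Fin 3) → EuclideanSpace ℝ (Fin 3)) (u : ℕ → ℝ → UnitAddTorus (Fin 3) → EuclideanSpace ℝ (Fin 3)) (U : ℕ → ℝ → Literature.Analysis.FunctionSpaces.Torus.energySpace (Fin 3)), (∀ j, 0 < ν j ∧ ν j ≤ 1) ∧ Filter.Tendsto ν Filter.atTop (nhds 0) ∧ (∀ j, Literature.Analysis.FluidPDE.Torus.IsGlobalLerayHopf (ν j) (fun _ => f) (u₀ j) (u j)) ∧ (∀ j t, 0 ≤ t → ((U j t : MeasureTheory.Lp (EuclideanSpace ℝ (Fin 3)) 2 (MeasureTheory.volume : MeasureTheory.Measure (UnitAddTorus (Fin 3)))) : UnitAddTorus (Fin 3) → EuclideanSpace ℝ (Fin 3)) =ᵐ[MeasureTheory.volume] u j t) ∧ ∀ j, Literature.Analysis.FluidPDE.meanEnergy (u j) ≤ E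

/-- item stmt-AnomalousDissipation-18403 · support · rank 9 · closed · proved by Summit.AnomalousDissipation.AnomalousDissipation.Theorems.TameRoughRigidity.rigiditySplit_proof @ 0f734fad02c7 (prover) · by planner
sources: FoiasManleyRosaTemam2001, Summits/AnomalousDissipation/AnomalousDissipation/Theses/EnsembleRigidity.lean
[support] the typed split N → K → R → X, PROVED (Sketch.lean `rigiditySplit_holds`, rc 0, 0 sorry; ≈
30 tactic lines: contraposition, R's threshold, vacuity patch with δ₀' = min δ₀ (r/2)); the same
proof is the `have hX` block of `closes`. A prover lands it verbatim; it is the glue for the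
parent's `--split GPStatisticalRigidity --into GPEulerCoercive TameClosure TameToRough`.
[difficulty: provable-now] -/
@[route_item "route-AnomalousDissipation-TameRoughRigidity"]
def RigiditySplit : Prop :=
  GPEulerCoercive → TameClosure → TameToRough → GPStatisticalRigidity

-- `RigiditySplit` holds: proved by `Summit.AnomalousDissipation.AnomalousDissipation.Theorems.TameRoughRigidity.rigiditySplit_proof` @ 0f734fad02c7 (its module imports this route file, so no `_holds` link can be stated here).

/-- item stmt-AnomalousDissipation-18404 · support · rank 9 · closed · proved by Summit.AnomalousDissipation.AnomalousDissipation.Theorems.TameRoughRigidity.gpOrientationBridge_proof @ d71578ccdc96 (prover) · by planner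
sources: Summits/AnomalousDissipation/AnomalousDissipation/Theses/ForcedSmallScales.lean, Summits/AnomalousDissipation/AnomalousDissipation/Theses/EnsembleRigidity.lean, FoiasManleyRosaTemam2001
[support] ORIENTATION BRIDGE: ForcedSmallScales.CyclicForceCoercive (stmt-1440: no Euler SSS of f₁ =
sin(2πx₁)e₀ + sin(2πx₂)e₁ + sin(2πx₀)e₂, stated verbatim) ↔ N. The swap σ : x₁ ↔ x₂ with components
permuted accordingly is an isometry of T³ carrying f_GP to f₁; Euler is covariant, so IsSSS 0 f_GP μ
↔ IsSSS 0 f₁ (σ_*μ) (push-forward on H: cylindrical tests, shells, enstrophy are σ-invariant).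
Provable now (M); links the two routes' efforts on the same object. [difficulty: provable-now] -/
@[route_item "route-AnomalousDissipation-TameRoughRigidity"]
def GPOrientationBridge : Prop :=
  (∀ μ : MeasureTheory.Measure (Literature.Analysis.FunctionSpaces.Torus.energySpace (Fin 3)), ¬ Literature.Analysis.FluidPDE.Torus.IsStationaryStatisticalSolution 0 (Literature.Analysis.FluidPDE.Torus.frameField (d := Fin 3) (Pi.single 1 1) 0 false + Literature.Analysis.FluidPDE.Torus.frameField (d := Fin 3) (Pi.single 2 1) 1 false + Literature.Analysis.FluidPDE.Torus.frameField (d := Fin 3) (Pi.single 0 1) 2 false) μ) ↔ GPEulerCoercive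

-- `GPOrientationBridge` holds: proved by `Summit.AnomalousDissipation.AnomalousDissipation.Theorems.TameRoughRigidity.gpOrientationBridge_proof` @ d71578ccdc96 (its module imports this route file, so no `_holds` link can be stated here).

/-- item stmt-AnomalousDissipation-18616 · support · rank 9 · closed · proved by Summit.AnomalousDissipation.AnomalousDissipation.Theorems.TameRoughRigidity.residualTransferSSS_proof @ 178a68dbe005 (prover) · by planner
sources: FoiasManleyRosaTemam2001, Summits/AnomalousDissipation/AnomalousDissipation/Theses/EnsembleRigidity.lean, Summits/AnomalousDissipation/AnomalousDissipation/Theorems/EnsembleRigidityResidualTransferSSS.lean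
[support] RESIDUAL TRANSFER AT THE ENSEMBLE LEVEL — the parent route's bridge item
EnsembleRigidity.ResidualTransferSSS (stmt-AnomalousDissipation-15510), byte-identical copy, ALREADY
PROVED (Theorems/EnsembleRigidityResidualTransferSSS.lean, ResidualTransferSSS_of @ 45f501a). For ν
> 0, f smooth divergence-free mean-zero and every stationary statistical solution μ of NS_ν(f) with
integrable energy: shell work ≥ 0 and the cylindrical forced-Euler defect is ≤
ν·√(ensembleEnstrophy)·‖∇Φ'‖_(L²(μ)). Filed here only so that the deciding theorem `closes` takes it
as a hypothesis instead of importing the Theorems file (cone repair 2026-08-17: the Theorems import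
dragged 111 Literature modules with unproved named facts into the route's import cone). Nothing to
prove. [difficulty: provable-now] [deps: none] -/
@[route_item "route-AnomalousDissipation-TameRoughRigidity", crux]
def ResidualTransferSSS : Prop :=
  ∀ (ν : ℝ) (f : UnitAddTorus (Fin 3) → EuclideanSpace ℝ (Fin 3)) (μ : MeasureTheory.Measure (Literature.Analysis.FunctionSpaces.Torus.energySpace (Fin 3))), 0 < ν → Literature.Analysis.FunctionSpaces.Torus.IsSmooth f → Literature.Analysis.FunctionSpaces.Torus.IsDivFree f → Literature.Analysis.FunctionSpaces.Torus.HasZeroMean f → Literature.Analysis.FluidPDE.Torus.IsStationaryStatisticalSolution ν f μ → MeasureTheory.Integrable (fun v : Literature.Analysis.FunctionSpaces.Torus.energySpace (Fin 3) => ‖v‖ ^ 2) μ → (∀ e₁ e₂ : ENNReal, e₁ < e₂ → 0 ≤ ∫ v in {v : Literature.Analysis.FunctionSpaces.Torus.energySpace (Fin 3) | e₁ ≤ ‖v‖ₑ ^ 2 ∧ ‖v‖ₑ ^ 2 < e₂}, Literature.Analysis.FluidPDE.Torus.pairing (v : MeasureTheory.Lp (EuclideanSpace ℝ (Fin 3))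 2 (MeasureTheory.volume : MeasureTheory.Measure (UnitAddTorus (Fin 3)))) f ∂μ) ∧ ∀ Φ : Literature.Analysis.FluidPDE.Torus.CylindricalTest (Fin 3), MeasureTheory.Integrable (fun v : Literature.Analysis.FunctionSpaces.Torus.energySpace (Fin 3) => Literature.Analysis.FluidPDE.Torus.nsGeneratorPairing 0 f v (Φ.grad v)) μ ∧ |∫ v, Literature.Analysis.FluidPDE.Torus.nsGeneratorPairing 0 f v (Φ.grad v) ∂μ| ≤ ν * Real.sqrt (Literature.Analysis.FluidPDE.Torus.ensembleEnstrophy μ).toReal * Real.sqrt (∫ v, Literature.Analysis.FunctionSpaces.Torus.gradNormSq (Φ.grad v) ∂μ)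

-- `ResidualTransferSSS` holds: proved by `Summit.AnomalousDissipation.AnomalousDissipation.Theorems.TameRoughRigidity.residualTransferSSS_proof` @ 178a68dbe005 (its module imports this route file, so no `_holds` link can be stated here).

/-- item stmt-AnomalousDissipation-18617 · support · rank 9 · closed · proved by Summit.AnomalousDissipation.AnomalousDissipation.Theorems.tameRoughRigidity_ensembleFloorTransfer_proof @ 8e7689d4c59e (prover) · by planner
sources: FoiasManleyRosaTemam2001, DoeringFoias2002, Summits/AnomalousDissipation/AnomalousDissipation/Theses/EnsembleRigidity.lean, Summits/AnomalousDissipation/AnomalousDissipation/Theorems/EnsembleRigidityEnsembleFloorTransfer.lean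
[support] ENSEMBLE FLOOR ⇒ PATH FLOOR — the parent route's bridge item
EnsembleRigidity.EnsembleFloorTransfer (stmt-AnomalousDissipation-15511), byte-identical copy,
ALREADY PROVED (Theorems/EnsembleRigidityEnsembleFloorTransfer.lean, EnsembleFloorTransfer_proof @
9e2071c). For ν > 0, f smooth divergence-free mean-zero: an ensemble dissipation floor ε₀ on every
SSS of NS_ν(f) with integrable energy ≤ E transfers to meanDissipation ν u ≥ ε₀ for every global
Leray–Hopf u with an H-valued lift and meanEnergy ≤ E. Filed here only so that `closes` takes it as
a hypothesis instead of importing the Theorems file (cone repair 2026-08-17). Nothing to prove.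
[difficulty: provable-now] [deps: none] -/
@[route_item "route-AnomalousDissipation-TameRoughRigidity", crux]
def EnsembleFloorTransfer : Prop :=
  ∀ (ν E ε₀ : ℝ) (f u₀ : UnitAddTorus (Fin 3) → EuclideanSpace ℝ (Fin 3)) (u : ℝ → UnitAddTorus (Fin 3) → EuclideanSpace ℝ (Fin 3)) (U : ℝ → Literature.Analysis.FunctionSpaces.Torus.energySpace (Fin 3)), 0 < ν → Literature.Analysis.FunctionSpaces.Torus.IsSmooth f → Literature.Analysis.FunctionSpaces.Torus.IsDivFree f → Literature.Analysis.FunctionSpaces.Torus.HasZeroMean f → (∀ μ : MeasureTheory.Measure (Literature.Analysis.FunctionSpaces.Torus.energySpace (Fin 3)), Literature.Analysis.FluidPDE.Torus.IsStationaryStatisticalSolution ν f μ → MeasureTheory.Integrable (fun v : Literature.Analysis.FunctionSpaces.Torus.energySpace (Fin 3) => ‖v‖ ^ 2) μ → Literature.Analysis.FluidPDE.Torus.ensembleEnergy μ ≤ E → ε₀ ≤ Literature.Analysis.FluidPDE.Torus.ensembleDissipation ν μ) → Literature.Analysis.FluidPDE.Torus.IsGlobalLerayHopf ν (fun _ =>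 f) u₀ u → (∀ t, 0 ≤ t → ((U t : MeasureTheory.Lp (EuclideanSpace ℝ (Fin 3)) 2 (MeasureTheory.volume : MeasureTheory.Measure (UnitAddTorus (Fin 3)))) : UnitAddTorus (Fin 3) → EuclideanSpace ℝ (Fin 3)) =ᵐ[MeasureTheory.volume] u t) → Literature.Analysis.FluidPDE.meanEnergy u ≤ E → ε₀ ≤ Literature.Analysis.FluidPDE.meanDissipation ν u

-- `EnsembleFloorTransfer` holds: proved by `Summit.AnomalousDissipation.AnomalousDissipation.Theorems.tameRoughRigidity_ensembleFloorTransfer_proof` @ 8e7689d4c59e (its module imports this route file, so no `_holds` link can be stated here).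

-- earlier Assembly (stmt-AnomalousDissipation-18405, replaced 2026-08-17T02:51:50Z -> stmt-AnomalousDissipation-18626): retired by None — GPEulerCoercive → TameClosure → TameToRough → GPMeanBoundedFamily → _root_.AnomalousDissipation
/-- item stmt-AnomalousDissipation-18626 · assembly · rank 1 · closed · proved by Summit.AnomalousDissipation.AnomalousDissipation.Theorems.tameRoughRigidity_assembly_proof @ b0c80cf6da6d (prover) · by planner
sources: FoiasManleyRosaTemam2001, DoeringFoias2002
[assembly] GPEulerCoercive → TameClosure → TameToRough → GPMeanBoundedFamily → ResidualTransferSSS →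
EnsembleFloorTransfer → AnomalousDissipation — exactly the type of the deciding theorem `closes`
(rev 1: the parent's two LANDED bridge items are hypotheses instead of by-name imports);
`assembly_holds : Assembly := closes` (Sketch.lean, rc 0, 0 sorry). -/
@[route_item "route-AnomalousDissipation-TameRoughRigidity"]
def Assembly : Prop :=
  GPEulerCoercive → TameClosure → TameToRough → GPMeanBoundedFamily → ResidualTransferSSS → EnsembleFloorTransfer → _root_.AnomalousDissipation

-- `Assembly` holds: proved by `Summit.AnomalousDissipation.AnomalousDissipation.Theorems.tameRoughRigidity_assembly_proof` @ b0c80cf6da6d (its module imports this route file, so no `_holds` link can be stated here).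

/-! D-0027 §2.1 — DECIDING THEOREM (planner-authored via `route open/edit --closes-file`; by planner-rglue-AnomalousDissipation-TameRoughR-1126c1a3-0 2026-08-17T09:59:37Z):
its hypotheses are this route's items and its conclusion the sub-problem Statement (glue_lint), and it elaborates with this file. -/

@[closes "route-AnomalousDissipation-TameRoughRigidity"] theorem closes (h₁ : GPEulerCoercive) (h₂ : TameClosure) (h₃ : TameToRough) (h₄ : GPMeanBoundedFamily)
    (h₅ : ResidualTransferSSS) (h₆ : EnsembleFloorTransfer) :
    _root_.AnomalousDissipation := by
  -- rev 3 (route-repair 2026-08-17, glue-native-fail): SELF-CONTAINED deciding theorem. Rev 2 ended in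
  -- `EnsembleRigidity.closes hX h₄ h₅ h₆`; the parent route's deciding theorem was re-cut on
  -- 2026-08-17T08:55Z (its first binder is now `GPTameDefectFloor`, X is derived inside it), so the
  -- call no longer typechecked (Theses file 506:88, application type mismatch). This proof uses ONLY
  -- this route's own item decls, Literature definitions and the landed Literature-only Theorems fact
  -- `stub_gpAdmissible` (f_GP smooth, divergence free, mean zero) — no decl of any other route.
  -- STEP 1. THE TYPED SPLIT N → K → R → X (= support item `RigiditySplit`, landed as
  -- Theorems.TameRoughRigidity.rigiditySplit_proof; re-proved inline because that module imports this file).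
  have hX : GPStatisticalRigidity := by
    intro f hf E
    -- (1a) N + K ⇒ a DEFECT GAP on every tame class (E', G₁): contraposition of the closure lemma K
    have gap : (∀ E G₁ : ℝ, ∃ r : ℝ, 0 < r ∧ ∀ μ : MeasureTheory.Measure (Literature.Analysis.FunctionSpaces.Torus.energySpace (Fin 3)), MeasureTheory.IsProbabilityMeasure μ → MeasureTheory.Integrable (fun v : Literature.Analysis.FunctionSpaces.Torus.energySpace (Fin 3) => ‖v‖ ^ 2) μ → Literature.Analysis.FluidPDE.Torus.ensembleEnergy μ ≤ E → Literature.Analysis.FluidPDE.Torus.ensembleEnstrophy μ ≤ ENNReal.ofReal G₁ → ¬ (∀ Φ : Literature.Analysis.FluidPDE.Torus.CylindricalTest (Fin 3), MeasureTheory.Integrable (fun v : Literature.Analysis.FunctionSpaces.Torus.energySpace (Fin 3) => Literature.Analysis.FluidPDE.Torus.nsGeneratorPairing 0 f v (Φ.grad v)) μ ∧ |∫ v, Literature.Analysis.FluidPDE.Torus.nsGeneratorPairing 0 f v (Φ.grad v) ∂μ| ≤ r * Real.sqrt (∫ v, Literature.Analysis.FunctionSpaces.Torus.gradNormSq (Φ.grad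 v) ∂μ))) := by
      intro E' G₁
      by_contra hcon
      push Not at hcon
      obtain ⟨μ, hμ, -⟩ := h₂ f hf E' G₁ hcon
      exact h₁ f hf μ hμ
    -- (1b) R turns the gap into the Onsager calibration on the rough class, with its own threshold G₁(E)
    obtain ⟨G₁, c, δ₀, hc, hδ₀, hrough⟩ := h₃ f hf gap E
    -- (1c) patch at G₁(E) with δ₀' = min δ₀ (r/2): below G₁ the gap r makes the defect hypothesis
    --      impossible (VACUITY), at or above G₁ the calibration is R's conclusion
    obtain ⟨r, hr, hgap⟩ := gap E G₁
    refine ⟨c, min δ₀ (r / 2), hc, lt_min hδ₀ (by linarith), ?_⟩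
    intro μ hprob hint hE hfin hshell R hR0 hRle hdef
    by_cases hcase : ENNReal.ofReal G₁ ≤ Literature.Analysis.FluidPDE.Torus.ensembleEnstrophy μ
    · exact hrough μ hprob hint hE hfin hcase hshell R hR0 (hRle.trans (min_le_left _ _)) hdef
    · exfalso
      have htame : Literature.Analysis.FluidPDE.Torus.ensembleEnstrophy μ ≤ ENNReal.ofReal G₁ := (not_le.mp hcase).le
      refine hgap μ hprob hint hE htame ?_
      intro Φ
      obtain ⟨hi, hb⟩ := hdef Φ
      refine ⟨hi, hb.trans ?_⟩
      have hRr : R ≤ r := hRle.trans ((min_le_right _ _).trans (by linarith))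
      exact mul_le_mul_of_nonneg_right hRr (Real.sqrt_nonneg _)
  -- STEP 2. X + B + the two landed bridges ⇒ the zeroth law (the parent route's assembly, re-proved
  -- here over THIS route's byte-identical copies so that no foreign `closes` is called).
  -- the pinned force and its admissibility (landed Literature-only Theorems fact)
  set fGP : UnitAddTorus (Fin 3) → EuclideanSpace ℝ (Fin 3) := fun x : UnitAddTorus (Fin 3) =>
    (Literature.Analysis.FluidPDE.Torus.stokesMode (Pi.single (2 : Fin 3) (1 : ℤ)) (EuclideanSpace.single (0 : Fin 3) (1 : ℝ)) false x +
      Literature.Analysis.FluidPDE.Torus.stokesMode (Pi.single (0 : Fin 3) (1 : ℤ)) (EuclideanSpace.single (1 : Fin 3) (1 : ℝ)) false x +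
      Literature.Analysis.FluidPDE.Torus.stokesMode (Pi.single (1 : Fin 3) (1 : ℤ)) (EuclideanSpace.single (2 : Fin 3) (1 : ℝ)) false x :
      EuclideanSpace ℝ (Fin 3)) with hfGP
  obtain ⟨hsm, hdf, hzm⟩ :=
    Summit.AnomalousDissipation.AnomalousDissipation.Theorems.SteadyStatesLoudBounded.GpAdmissible.stub_gpAdmissible
  -- B: the mean-bounded lifted Leray–Hopf family of f_GP
  obtain ⟨E, ν, u₀, u, U, hν, hν0, hLH, hU, hE⟩ := h₄ fGP hfGP
  -- X: rigidity constants at level E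
  obtain ⟨c, δ₀, hc, hδ₀, hrig⟩ := hX fGP hfGP E
  set ε₀ : ℝ := min c (δ₀ ^ 2) with hε₀
  have hε₀pos : 0 < ε₀ := lt_min hc (pow_pos hδ₀ 2)
  -- ensemble dissipation floor ε₀ at level E for every stationary statistical solution of NS_ν'(f_GP),
  -- ν' ∈ (0,1]: residual transfer (h₅) gives shell work ≥ 0 and defect ≤ ν'√G·‖∇Φ'‖, so with
  -- R := ν'√G either R ≤ δ₀ and rigidity pays c ≤ R√G = ν'G, or R > δ₀ and ν'G = R²/ν' ≥ R² > δ₀².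
  have floor : ∀ ν' : ℝ, 0 < ν' → ν' ≤ 1 →
      ∀ μ : MeasureTheory.Measure (Literature.Analysis.FunctionSpaces.Torus.energySpace (Fin 3)),
        Literature.Analysis.FluidPDE.Torus.IsStationaryStatisticalSolution ν' fGP μ →
        MeasureTheory.Integrable (fun v : Literature.Analysis.FunctionSpaces.Torus.energySpace (Fin 3) => ‖v‖ ^ 2) μ →
        Literature.Analysis.FluidPDE.Torus.ensembleEnergy μ ≤ E →
        ε₀ ≤ Literature.Analysis.FluidPDE.Torus.ensembleDissipation ν' μ := by
    intro ν' hν' hν'1 μ hμ hint hEμ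
    have hfin : Literature.Analysis.FluidPDE.Torus.ensembleEnstrophy μ < ⊤ := hμ.enstrophy_finite
    obtain ⟨hshell, hres⟩ := h₅ ν' fGP μ hν' hsm hdf hzm hμ hint
    set G : ℝ := (Literature.Analysis.FluidPDE.Torus.ensembleEnstrophy μ).toReal with hG
    have hG0 : 0 ≤ G := ENNReal.toReal_nonneg
    have hsq : Real.sqrt G * Real.sqrt G = G := Real.mul_self_sqrt hG0
    set R : ℝ := ν' * Real.sqrt G with hR
    have hR0 : 0 ≤ R := mul_nonneg hν'.le (Real.sqrt_nonneg _)
    have hdiss : Literature.Analysis.FluidPDE.Torus.ensembleDissipation ν' μ = ν' * G := rfl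
    rw [hdiss]
    by_cases hRδ : R ≤ δ₀
    · -- rigidity branch: c ≤ R √G = ν' G
      have key := hrig μ hμ.prob hint hEμ hfin hshell R hR0 hRδ
        (fun Φ => ⟨(hres Φ).1, by simpa [hR, mul_assoc] using (hres Φ).2⟩)
      have : R * Real.sqrt G = ν' * G := by rw [hR, mul_assoc, hsq]
      calc ε₀ ≤ c := min_le_left _ _
        _ ≤ R * Real.sqrt G := key
        _ = ν' * G := this
    · -- large-residual branch: ν' G = R² / ν' ≥ R² > δ₀²
      have hRgt : δ₀ < R := lt_of_not_ge hRδ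
      have hR2 : δ₀ ^ 2 < R ^ 2 := by
        have := hδ₀.le
        nlinarith
      have hRsq : R ^ 2 = ν' * (ν' * G) := by
        have hsq2 : Real.sqrt G ^ 2 = G := Real.sq_sqrt hG0
        calc R ^ 2 = ν' ^ 2 * Real.sqrt G ^ 2 := by rw [hR]; ring
          _ = ν' * (ν' * G) := by rw [hsq2]; ring
      have hνG0 : 0 ≤ ν' * G := mul_nonneg hν'.le hG0
      have hle : R ^ 2 ≤ ν' * G := by
        rw [hRsq]
        calc ν' * (ν' * G) ≤ 1 * (ν' * G) := by
              exact mul_le_mul_of_nonneg_right hν'1 hνG0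
          _ = ν' * G := one_mul _
      calc ε₀ ≤ δ₀ ^ 2 := min_le_right _ _
        _ ≤ R ^ 2 := hR2.le
        _ ≤ ν' * G := hle
  -- path floor along the family (bridge h₆), then the summit witnesses
  have hdissj : ∀ j, ε₀ ≤ Literature.Analysis.FluidPDE.meanDissipation (ν j) (u j) := fun j =>
    h₆ (ν j) E ε₀ fGP (u₀ j) (u j) (U j) (hν j).1 hsm hdf hzm (floor (ν j) (hν j).1 (hν j).2)
      (hLH j) (hU j) (hE j)
  exact ⟨fGP, hsm, hdf, hzm, ν, u₀, u, fun j => (hν j).1, hν0, hLH, ⟨E, hE⟩, ε₀, hε₀pos, hdissj⟩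

end Summit.AnomalousDissipation.AnomalousDissipation.Theses.TameRoughRigidity
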